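import Summits.QuantumFields.YangMills.Theorems.BalabanUVNodesN05SubBP2DK2PerKappaSlotExistsOfBindersPerP5Letters
import Literature.MathematicalPhysics.QuantumFieldTheory.Balaban1983to89.B9SupplySockH59ZdSrcPer
import Literature.MathematicalPhysics.QuantumFieldTheory.Balaban1983to89.B9SupplySockB9P3ZdH2PerClass

/-!
# BalabanUVNodes ∕ N05 ([Balaban1985RegularSpaces] Lemma 1 p. 79 – Thm 8 p. 101, Prop. 5 p. 94, §3 p. 98, (1.3)–(1.5) p. 77, p. 77 «Ω_j ⊂ T_η»; [Balaban1985BackgroundPropagators]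
# Thm 3.1 p. 397, Thm 3.3 p. 399, (3.42)–(3.47) p. 398, Thm 3.11 p. 416): (13)′δ — THE WITNESS SLOT OF RECORD Slot8κ′ WITH ALL N06 b9-FRAME INPUTS FED BY NAME FROM NODE N06's
# PERIODIC BINDER LEVEL AT EVERY TRUNCATION (dag-n06-b FILE 7 `B9SupplySockH59ZdSrcPer` p663900 + FILE 8 `B9SupplySockB9P3ZdH2PerClass`) — (13)′β ∘ N06

Track A of `YM-PLAN.md` (cell `pub-ymgap`, HUMAN RULING D-0062), node **N05**; seat `pub-ymgap-dag-n05-d` (g15), 2026-08-28; bears on K1⁹ `stmt-QuantumFields-27364`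
(`--supports … --as helper`, count-neutral).  WORK-SPLIT-2 with dag-n05-c g18 (I.42831∕I.42849): this seat = the N06-frame feeds + the final head; dag-n05-c = the Prop-5-frame
served sockets `SP5base ∕ SP5` (`…N05SubBP2DK2PerP5FrameSocketsServed`, after lit-balaban r05's sourced nested server).

WHAT.  (13)′β `…OfBindersPerP5Letters.exists_residB8_slot8κ'_of_bindersPer_p5Letters_at` displays, at the print-class periodic members `a : Node00.IdxB8SubDPerκ θ P Mκ Rκ`, the
guarded sourced b9 socket of Theorem 4's frame `SH59src` (dag-n05-c T5∕T6c's text; [4] Thm 3.3 with periodic source at every truncation `m ≤ k`), the guarded both-points socket of Proposition 3's frame `SB9H2Per` at print's class, and N06's five analytic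
binders at truncation `k`.  HERE:
* `SH59src` := dag-n06-b's ★★★ `B9SupplySockH59ZdSrcPer.sockH59srcPer_opsAllZdPer_towerBondsP` at `J := IdxB8SubDPerκ θ P Mκ Rκ`, `ι := toZdIdx`, `p := fun _ => P`, `γ := γ₈`,
  `B₈`, `B₀″ := B₀′` — its member laws at EVERY truncation DISCHARGED from the index (`a.pos`, `a.Ω_zero`, `a.dvd`, `B8PeriodicMemberGeometry.IdxB8SubD.isPeriodic_towerBondsP_Λs`
  with `IdxB8SubDPer.pow_mul_div`, `levelSepPP0_of_levelSepPP ∘ IdxB8SubD.levelSepPP_towerBondsP`); its threshold `min cP₃ (cP₃ ∕ (2(L·5dLB₈) + 8(8B₀′·5dLB₈)))` absorbed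
  (`cP ↦ min cP ·` by antitonicity); its allowance constant pins `γ′ = 2c_Sγ₈ ∕ B₀` (a FIFTH equation; the door passes `rfl`).
* `SB9H2Per` := dag-n06-b's ★★★ `B9SupplySockB9P3ZdH2PerClass.sockB9P3H2Per_opsAllZdPer_towerBondsP` (the class-map-generic H2 supplier at print's class, LOCATED-JUNCTION-SHAPE
  → INTENT-8) at each member, truncation `k`, from the SAME three binders `InvAtHIPer ∕ GlobAtIPer ∕ HolderAtIH2Per`; its threshold `min{1∕16, aI, aT, 1∕(2B₀ᴺ·14(d−1)·M+1)}`
  is Proposition 3's `cP₃′` inside.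
DISPLAYED INSTEAD: N06's FIVE ANALYTIC BINDERS per member AT EVERY TRUNCATION `m ≤ k` (`InvAtHIPer aI`, `GlobAtIPer aT B₀ᴺ`, `HolderAtIH2Per aT C_β β len`, `SrcAtIPer aS c_S`,
`SrcHolderAtIH2Per aS c_Sβ` at the genuine torus record `opsAllZdPer τ θ.L P (fun k j => towerBondsP θ.L Ω (Λs k) j) ops₀`; the truncation-`k` instances feed (13)′β).  UNCHANGED
from (13)′β: `SP5base ∕ SP5` (dag-n05-c's §4 to serve), [4]'s Proposition-5 letters `SLet ∕ SLetUB` at the periodic members of record, Proposition 6 in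
dag-n05-e's served shape, Theorem 8's constants OUTER with (8′)∕(9′)'s inequalities, the N06 pin (now FIVE equations).
WHAT IS PROVED (one theorem; no estimate; no new definition): ★★★ `exists_residB8_slot8κ'_of_bindersPerAll_p5Letters_at` — at a given period `P`:
`∃ lam c₁ ρ₀ ax, 0 < c₁ ∧ 1 ≤ ρ₀ ∧ B8LeafOfRecordSubBP₂DPerκ θ P Mκ Rκ ⟨lam.cutSubBP₅κPer P Mκ Rκ c₁ ρ₀, ax⟩`.
AFTER THIS FILE the N05 witness slot of record at `P` rests on: N06's five analytic binders per print-class periodic member and truncation (N06's object layer: theorems so far at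
the torus member `torusIdx` only — dag-n06-b p662241 §5, p663900 §4), [4]'s Proposition-5 letters at periodic arguments (N06 ∕ lit-balaban), `SP5base ∕ SP5` (r05's E-ii
stack → dag-n05-c §4), Proposition 6 in dag-n05-e's served shape (PROVED: `prop6Printed_zdCubP_γ_holds_record_dvd`, door recipe), numeric side conditions on
the outer constants.
HONEST FRAMING: composition BY NAME; 0 estimates of Bałaban's ∕ [4]'s proved here; EVERY displayed letter ∕ binder ∕ socket ∕ `hP6`'s family remains a HYPOTHESIS of print's ∕ [4]'s
shape; Proposition 7's slot junk-inhabited (census, (10)′ A); count-neutral; **N05 NOT discharged** (director-ym №227 (b)); FLAG №4 OPEN; K1⁹ NOT claimed; Bałaban AS PRINTED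
(Thm 8 SURVIVING form, GAPS G-B8-13); one finite 𝕋⁴ programme at fixed ε; nothing continuum ∕ ℝ⁴ ∕ OS ∕ mass-gap ∕ Clay.  No `sorry`, no new definition.  Unit `pub-ymgap-dag-n05-d` (g15).
[cite: Balaban1985RegularSpaces, Lemma 1 p.79, Thm 2 p.83, Prop. 3 p.87, Thm 4 p.88, Prop. 5 (1.107)–(1.109) p.94, §3 p.98, Prop. 6 p.99, Prop. 7 p.100, Thm 8 (1.146) p.101, (1.58)–(1.59) p.86, (1.31) p.82, (1.3)–(1.5) p.77, p.77 («Ω_j ⊂ T_η»); Balaban1985BackgroundPropagators, Thm 3.1 p.397, Thm 3.3 p.399, (3.42)–(3.47) p.398, Thm 3.11 p.416, (3.40) p.397; Balaban1984PropagatorsII, (2.3) p.224]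
-/

noncomputable section

namespace Summit.QuantumFields.YangMills.BalabanUVNodes.N05SubBP2DK2PerKappaSlotExistsOfBindersPerAllP5Letters

open Literature.MathematicalPhysics.QuantumFieldTheory.Balaban1983to89
open Literature.MathematicalPhysics.QuantumFieldTheory.Balaban1983to89.Node00
open Literature.MathematicalPhysics.QuantumFieldTheory.Balaban1983to89.B8IdxB8LawsB (IdxB8LawsB IdxB8SubB)
open Literature.MathematicalPhysics.QuantumFieldTheory.Balaban1983to89.B8LeafModelZd (ZdIdx)
open Literature.MathematicalPhysics.QuantumFieldTheory.Balaban1983to89.B8LeafModelZdHP2Per (zdGF3HP₂Per)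
open Literature.MathematicalPhysics.QuantumFieldTheory.Balaban1983to89.B8TowerBondsPrinted (towerBondsP)
open Literature.MathematicalPhysics.QuantumFieldTheory.Balaban1983to89.B8Lemma1NonAbelian (mulCfg)
open Literature.MathematicalPhysics.QuantumFieldTheory.Balaban1983to89.B8LanF146 (LanF146)
open Literature.MathematicalPhysics.QuantumFieldTheory.Balaban1983to89.B8Prop5LandauDataZdPer (zdLanPer)
open Literature.MathematicalPhysics.QuantumFieldTheory.Balaban1983to89.B8Prop5LandauDataZd (ZdLanIdx)
open Literature.MathematicalPhysics.QuantumFieldTheory.Balaban1983to89.B8LeafModelZd3SockH2Per (SockB9P3H2Per)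
open Literature.MathematicalPhysics.QuantumFieldTheory.Balaban1983to89.B9SupplySockB9P3ZdSrcPer (SrcAtIPer SrcHolderAtIH2Per)
open Literature.MathematicalPhysics.QuantumFieldTheory.Balaban1983to89.B9SupplySockB9P3ZdLetters (OpsZd)
open Literature.MathematicalPhysics.QuantumFieldTheory.Balaban1983to89.B9Eq327GreenZdHermPer (InvAtHIPer)
open Literature.MathematicalPhysics.QuantumFieldTheory.Balaban1983to89.B9SupplySockB9P3ZdPer (GlobAtIPer)
open Literature.MathematicalPhysics.QuantumFieldTheory.Balaban1983to89.B9SupplySockB9P3ZdH2Per (HolderAtIH2Per)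
open Literature.MathematicalPhysics.QuantumFieldTheory.Balaban1983to89.B9SupplySockB9P3ZdAllLettersZdPer (opsAllZdPer)
open Literature.MathematicalPhysics.QuantumFieldTheory.Balaban1983to89.B9Eq316AveragingTransposeZd (betaTau qQ)
open Summit.QuantumFields.YangMills.BalabanUVNodes.N05SubBP2DK2PerKappaSlotExistsOfBindersPerP5Letters (IdxB8SubDPer.Λs_add_div_smul_iff
  exists_residB8_slot8κ'_of_bindersPer_p5Letters_at)
open Literature.MathematicalPhysics.QuantumFieldTheory.Balaban1983to89.B9SupplySockH59ZdSrcPer (sockH59srcPer_opsAllZdPer_towerBondsP)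
open Literature.MathematicalPhysics.QuantumFieldTheory.Balaban1983to89.B9Eq316AveragingTransposeZdLevelZero (LevelSepPP0 levelSepPP0_of_levelSepPP)
open Literature.MathematicalPhysics.QuantumFieldTheory.Balaban1983to89.B8TowerBondsLayerLawSubD (IdxB8SubD.levelSepPP_towerBondsP)
open Literature.MathematicalPhysics.QuantumFieldTheory.Balaban1983to89.B9SupplySockB9P3ZdH2PerClass (sockB9P3H2Per_opsAllZdPer_towerBondsP)
open T4TermwiseTorus (IsPeriodic)
open MatrixLog B7Prop1Explicit B7Prop2Explicit B7Prop1Local B7Eq92Concrete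
open B8Ineq130 (tlo thi)
open B8Ineq132 (InAk covDerivFwd)
open B8Eq119TwistedAxial (Restr129 InAx bgT)
open B8Eq140Level (SideTouches)
open B8Eq138LandauZd (covLap covDivB QT logCfg InR138 IsLandau146W)
open B8Eq184Proof (gaugeExp cfgExp)
open B8Eq146AExpansion (iEta plaqCovDeriv)
open B8Eq143PlaqExpansion (pdiv)
open B7Prop4GeneralLevels (linCovIter)
open B8Eq155JBound (Jcur wsup)
open B8ScaledSupNorm (bondNorm msup Bdd)
open B9Eq340HolderZd (hquot AdmPair)
open B7Eq78Linearization (zdBlocking QprimeIter)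
open B8Eq1117Concrete (XSpace)
open B8Prop5ContractionKLevel (Bd2)
open B8LambdaSpaceKLevel (wt)

-- `Site` alone could resolve to the torus sites of `Setup.lean`; re-export the `ℤ^d` sites of `B7Prop1Explicit`.
export B7Prop1Explicit (Site)

section BindersPerAll

variable (θ : Stage3Params)

/-- ★★★ **THE WITNESS SLOT OF RECORD FROM NODE N06's PERIODIC BINDERS AT EVERY TRUNCATION AND [4]'s PERIODIC PROPOSITION-5 LETTERS, AT A GIVEN PERIOD `P`** — (13)′β with
`SH59src` := dag-n06-b's `B9SupplySockH59ZdSrcPer.sockH59srcPer_opsAllZdPer_towerBondsP` (FILE 7) and `SB9H2Per` := dag-n06-b's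
`B9SupplySockB9P3ZdH2PerClass.sockB9P3H2Per_opsAllZdPer_towerBondsP` (FILE 8), member laws from the index at every truncation `m ≤ k`; displayed instead: N06's five
analytic binders per member AT EVERY TRUNCATION `m ≤ k`; `γ′` pinned to N06's expression; everything else of (13)′β verbatim.
[cite: Balaban1985RegularSpaces, Lemma 1 – Thm 8 pp.79–101, Prop. 5 (1.107)–(1.109) p.94, §3 p.98, (1.3)–(1.5) p.77, p.77 («Ω_j ⊂ T_η»); Balaban1985BackgroundPropagators, Thm 3.1 p.397, Thm 3.3 p.399, (3.42)–(3.47) p.398, Thm 3.11 p.416] -/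
theorem exists_residB8_slot8κ'_of_bindersPerAll_p5Letters_at (hD : 2 ≤ θ.D) [FiniteDimensional ℝ θ.𝔸] (Mκ Rκ P : ℕ)
    -- NODE N06's GENUINE TORUS RECORD DATA: a faithful Hermitian tracial state `τ` with its Cauchy–Schwarz constant `C_τ`, the base letters `ops₀`, the block parameter `M ≥ 1`
    (τ : θ.𝔸 →ₗ[ℂ] ℂ) (hτp : ∀ a : θ.𝔸, a ≠ 0 → 0 < (τ (star a * a)).re) (hτt : ∀ a b : θ.𝔸, τ (a * b) = τ (b * a))
    (hτs : ∀ a : θ.𝔸, τ (star a) = starRingEnd ℂ (τ a)) {Cτ : ℝ} (hCτ : ∀ x y : θ.𝔸, |(τ (star x * y)).re| ≤ Cτ * ‖x‖ * ‖y‖)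
    (ops₀ : ℝ → ZdIdx θ.D θ.L → ℕ → OpsZd θ.D θ.𝔸) {M : ℝ} (hM1 : 1 ≤ M)
    -- NODE N06's BINDER CONSTANTS ([4] Thm 3.11's `a_I`, (3.47)'s `a_T, B₀ᴺ`, (3.45)'s `C_β`, the source binders' `a_S, c_S, c_Sβ`) — OUTER
    {aI aT aS B₀N Cβ cS cSβ : ℝ} (haI : 0 < aI) (haT : 0 < aT) (haS : 0 < aS) (hB₀N : 0 < B₀N) (hCβ : 0 < Cβ) (hcS : 0 ≤ cS) (hcSβ : 0 ≤ cSβ)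
    -- the primitive constants of the layer ([4] (3.40) `B₀` AS N06 SERVES IT, the free constant `B₀′` = (1.108)'s, the Hölder pair) — OUTER; `B₀`, `B₀β` PINNED to N06's expressions
    {B₀ B₀' B₀β β : ℝ} {len : Site θ.D → ℝ} (hB₀' : 0 < B₀')
    (hB₀eq : B₀ = max 1 (2 * B₀N * max 1 (qQ θ.D θ.L Cτ (betaTau τ) 1)))
    (hB₀βeq : B₀β = 2 * max 0 Cβ * max 1 (qQ θ.D θ.L Cτ (betaTau τ) 1))
    -- [4]'s PROPOSITION-5 LETTER CONSTANTS ((1.92)'s `B₀′ᴴ, B₂′`, (1.101)'s `B_G`, (1.98)'s `B_R`), the regularity threshold `c_L`, the free-constant relation of (1.108) — OUTER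
    {B₀'H B₂' BG BR cL : ℝ} (hB₀'H : 0 < B₀'H) (hB₂' : 0 ≤ B₂') (hBG : 0 ≤ BG) (hBR : 0 ≤ BR) (hcL : 0 < cL)
    (hfree : 3 * (2 * (θ.D : ℝ) * (θ.L : ℝ) ^ 2) * BG * BR ≤ B₀' / 2)
    -- PROPOSITION 6 IN dag-n05-e's SERVED SHAPE (`prop6Printed_zdCubP_γ_holds_record_dvd`): print cubes at `ρ₀`, constants `B₁⋆, c₁⋆` — OUTER, displayed
    {ρ₀ : ℕ} {B₁s c₁s : ℝ} (hρ₀ : 1 ≤ ρ₀) (hc₁s : 0 < c₁s)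
    (hP6 : ∀ {ι : Type} (f : ι → ZdIdx θ.D θ.L) (B₁'' c₁'' : ℝ), B₁s ≤ B₁'' → c₁'' ≤ c₁s →
      B8.Prop6Printed θ.D (θ.L : ℝ) B₁'' c₁'' (fun j => zdCubP θ.𝔸 θ.L ρ₀ (f j)))
    -- Theorem 8's constants — OUTER, with (8′)∕(9′)'s inequalities and `B₁⋆ ≤ 5dLB₈(1+11d²)`; `γ′`, `γ″`, `γβ` PINNED to N06's expressions;
    -- `cP` = the common threshold of the two displayed Thm-4-frame sockets `SP5base ∕ SP5` (the served sockets' radii ∕ thresholds are absorbed inside)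
    {cP γ₈ γ' γ'' γβ B₈ B₈β : ℝ} (hcP : 0 < cP) (hγ₈ : 1 ≤ γ₈)
    (hγ'eq : γ' = 2 * cS * γ₈ / max 1 (2 * B₀N * max 1 (qQ θ.D θ.L Cτ (betaTau τ) 1)))
    (hγ''eq : γ'' = 2 * cS * γ₈ / max 1 (2 * B₀N * max 1 (qQ θ.D θ.L Cτ (betaTau τ) 1)))
    (hγβeq : γβ = (max 0 Cβ * cS / B₀N + cSβ) * γ₈)
    (hB : 2 ≤ 5 * (θ.D : ℝ) * θ.L * B₀) (hB₀8 : B₀ ≤ B₈)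
    (hγB : 5 * (θ.D : ℝ) * θ.L * B₀ + 2 * (γ' * B₀) ≤ 5 * (θ.D : ℝ) * θ.L * B₈)
    (hγB'' : 5 * (θ.D : ℝ) * θ.L * B₀ + 2 * (γ'' * B₀) ≤ 5 * (θ.D : ℝ) * θ.L * B₈)
    (hB8β : 5 * (θ.D : ℝ) * θ.L * B₀β + 2 * B₀β * (γ'' * B₀) + γβ ≤ 5 * (θ.D : ℝ) * θ.L * B₈β)
    (hB₁big : B₁s ≤ 5 * (θ.D : ℝ) * θ.L * B₈ * (1 + 11 * (θ.D : ℝ) ^ 2))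
    -- PROPOSITION 5's EXISTENCE SOCKETS OF THEOREM 4's FRAME AT (1.146) `SP5base ∕ SP5` (dag-n05-c's (9′) texts VERBATIM, as in (10)′ A ∕ (13)′α∕β),
    -- at the PRINT-CLASS PERIODIC MEMBERS `a : IdxB8SubDPerκ θ P Mκ Rκ` (member `a.toZdIdx`, period `P`) — HYPOTHESES (server: lit-balaban r05's sourced nested E-ii stack; dag-n05-c's §4)
    (SP5base : ∀ a : IdxB8SubDPerκ θ P Mκ Rκ, ∀ α₀ α₁ : ℝ, 0 < α₀ → 0 < α₁ → α₀ + α₁ ≤ cP →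
      ∀ U₀ U' : Site θ.D → Fin θ.D → θ.𝔸ˣ, (∀ x κ, U₀ x κ ∈ unitaryUnits θ.𝔸) → (∀ x κ, U' x κ ∈ unitaryUnits θ.𝔸) →
      IsPeriodic P U₀ → IsPeriodic P U' → ∀ φ : Site θ.D → θ.𝔸, (((InR138 θ.L a.toZdIdx.k a.toZdIdx.η (a.toZdIdx.Ω 0) (a.toZdIdx.Λs a.toZdIdx.k) U₀ φ ∧ (∀ x, IsSelfAdjoint (φ x)) ∧ (∀ x, x ∉ a.toZdIdx.Ω 0 → φ x = 0) ∧
          Bdd θ.L a.toZdIdx.k a.toZdIdx.η (-(2 : ℝ)) (fun j (x : Site θ.D) => x ∈ a.toZdIdx.Ω j) φ) ∧ IsPeriodic P φ) ∧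
        msup θ.L a.toZdIdx.k a.toZdIdx.η (-(2 : ℝ)) (fun j (x : Site θ.D) => x ∈ a.toZdIdx.Ω j) φ < γ₈ * (α₀ + α₁)) →
      InAk θ.L a.toZdIdx.k a.toZdIdx.η α₀ a.toZdIdx.Ω U₀ → InAk θ.L a.toZdIdx.k a.toZdIdx.η α₀ a.toZdIdx.Ω (mulCfg U' U₀) → (∀ m, m ≤ a.toZdIdx.k → InAx θ.L m (a.toZdIdx.Λs m) U₀ (mulCfg U' U₀)) →
      (∀ j, j ≤ a.toZdIdx.k → ∀ (z : Site θ.D) (μ : Fin θ.D),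
        ((∀ x, InBox (tlo θ.L z j) (thi θ.L z j) x → x ∈ a.toZdIdx.Ω j) ∨ (∀ x, InBox (tlo θ.L (z + e μ) j) (thi θ.L (z + e μ) j) x → x ∈ a.toZdIdx.Ω j)) →
        ‖(avgIter θ.L (mulCfg U' U₀) j z μ : θ.𝔸) - (avgIter θ.L U₀ j z μ : θ.𝔸)‖ ≤ α₁) →
      (∀ b ∈ {b : Site θ.D × Fin θ.D | SideTouches (a.toZdIdx.Ω 0) b.1 b.2}, ‖((U' b.1 b.2 : θ.𝔸ˣ) : θ.𝔸) - 1‖ ≤ α₁) →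
      (∃ (v : Site θ.D → θ.𝔸ˣ) (la : Site θ.D → θ.𝔸), (∀ x, v x ∈ unitaryUnits θ.𝔸) ∧ (∀ x, x ∉ a.toZdIdx.Ω 0 → v x = 1) ∧
        (∀ j, j ≤ 1 → ∀ b ∈ {b : Site θ.D × Fin θ.D | SideTouches (a.toZdIdx.Ω j) b.1 b.2}, (v b.1 : θ.𝔸) = ((gaugeExp la b.1 : θ.𝔸ˣ) : θ.𝔸) ∧
        (v (b.1 + e b.2) : θ.𝔸) = ((gaugeExp la (b.1 + e b.2) : θ.𝔸ˣ) : θ.𝔸)) ∧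
        (∀ j, j ≤ 1 → ∀ b ∈ {b : Site θ.D × Fin θ.D | SideTouches (a.toZdIdx.Ω j) b.1 b.2},
        ‖la b.1‖ ≤ (8 * B₀' * (5 * (θ.D : ℝ) * θ.L * B₈) * (α₀ + α₁)) ∧ ((θ.L : ℝ) ^ j * a.toZdIdx.η) * ‖covDerivFwd a.toZdIdx.η U₀ b.2 la b.1‖ ≤ (8 * B₀' * (5 * (θ.D : ℝ) * θ.L * B₈) * (α₀ + α₁))) ∧
        LanF146 θ.L a.toZdIdx.k a.toZdIdx.η (a.toZdIdx.Ω 0) a.toZdIdx.Λs U₀ φ 1 (mgauge U₀ v⁻¹ U') ∧ Restr129 θ.L 1 (a.toZdIdx.Λs 1) U₀ ((1 : Site θ.D → θ.𝔸ˣ) * v) ∧ IsPeriodic P v))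
    (SP5 : ∀ a : IdxB8SubDPerκ θ P Mκ Rκ, ∀ α₀ α₁ : ℝ, 0 < α₀ → 0 < α₁ → α₀ + α₁ ≤ cP →
      ∀ U₀ U' : Site θ.D → Fin θ.D → θ.𝔸ˣ, (∀ x κ, U₀ x κ ∈ unitaryUnits θ.𝔸) → (∀ x κ, U' x κ ∈ unitaryUnits θ.𝔸) →
      IsPeriodic P U₀ → IsPeriodic P U' → ∀ φ : Site θ.D → θ.𝔸, (((InR138 θ.L a.toZdIdx.k a.toZdIdx.η (a.toZdIdx.Ω 0) (a.toZdIdx.Λs a.toZdIdx.k) U₀ φ ∧ (∀ x, IsSelfAdjoint (φ x)) ∧ (∀ x, x ∉ a.toZdIdx.Ω 0 → φ x = 0) ∧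
          Bdd θ.L a.toZdIdx.k a.toZdIdx.η (-(2 : ℝ)) (fun j (x : Site θ.D) => x ∈ a.toZdIdx.Ω j) φ) ∧ IsPeriodic P φ) ∧
        msup θ.L a.toZdIdx.k a.toZdIdx.η (-(2 : ℝ)) (fun j (x : Site θ.D) => x ∈ a.toZdIdx.Ω j) φ < γ₈ * (α₀ + α₁)) →
      InAk θ.L a.toZdIdx.k a.toZdIdx.η α₀ a.toZdIdx.Ω U₀ → InAk θ.L a.toZdIdx.k a.toZdIdx.η α₀ a.toZdIdx.Ω (mulCfg U' U₀) → (∀ m, m ≤ a.toZdIdx.k → InAx θ.L m (a.toZdIdx.Λs m) U₀ (mulCfg U' U₀)) →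
      (∀ j, j ≤ a.toZdIdx.k → ∀ (z : Site θ.D) (μ : Fin θ.D),
        ((∀ x, InBox (tlo θ.L z j) (thi θ.L z j) x → x ∈ a.toZdIdx.Ω j) ∨ (∀ x, InBox (tlo θ.L (z + e μ) j) (thi θ.L (z + e μ) j) x → x ∈ a.toZdIdx.Ω j)) →
        ‖(avgIter θ.L (mulCfg U' U₀) j z μ : θ.𝔸) - (avgIter θ.L U₀ j z μ : θ.𝔸)‖ ≤ α₁) →
      (∀ b ∈ {b : Site θ.D × Fin θ.D | SideTouches (a.toZdIdx.Ω 0) b.1 b.2}, ‖((U' b.1 b.2 : θ.𝔸ˣ) : θ.𝔸) - 1‖ ≤ α₁) →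
      (∀ m, 1 ≤ m → m < a.toZdIdx.k → ∀ (u₁ : Site θ.D → θ.𝔸ˣ) (U₁ : Site θ.D → Fin θ.D → θ.𝔸ˣ) (A : Site θ.D → Fin θ.D → θ.𝔸),
        (∀ x, u₁ x ∈ unitaryUnits θ.𝔸) → (∀ x, x ∉ a.toZdIdx.Ω 0 → u₁ x = 1) → IsPeriodic P u₁ → IsPeriodic P U₁ → IsPeriodic P A →
        mgauge U₀ u₁ U₁ = U' → Restr129 θ.L m (a.toZdIdx.Λs m) U₀ u₁ →
        LanF146 θ.L a.toZdIdx.k a.toZdIdx.η (a.toZdIdx.Ω 0) a.toZdIdx.Λs U₀ φ m U₁ →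
        (∀ j, j ≤ m → ∀ b ∈ {b : Site θ.D × Fin θ.D | SideTouches (a.toZdIdx.Ω j) b.1 b.2},
        U₁ b.1 b.2 = cfgExp a.toZdIdx.η A b.1 b.2 ∧ IsSelfAdjoint (A b.1 b.2) ∧ ‖A b.1 b.2‖ ≤ (5 * (θ.D : ℝ) * θ.L * B₈ * (α₀ + α₁)) * ((θ.L : ℝ) ^ j * a.toZdIdx.η)⁻¹) →
        ∃ (v : Site θ.D → θ.𝔸ˣ) (la : Site θ.D → θ.𝔸), (∀ x, v x ∈ unitaryUnits θ.𝔸) ∧ (∀ x, x ∉ a.toZdIdx.Ω 0 → v x = 1) ∧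
        (∀ j, j ≤ m + 1 → ∀ b ∈ {b : Site θ.D × Fin θ.D | SideTouches (a.toZdIdx.Ω j) b.1 b.2}, (v b.1 : θ.𝔸) = ((gaugeExp la b.1 : θ.𝔸ˣ) : θ.𝔸) ∧
        (v (b.1 + e b.2) : θ.𝔸) = ((gaugeExp la (b.1 + e b.2) : θ.𝔸ˣ) : θ.𝔸)) ∧
        (∀ j, j ≤ m + 1 → ∀ b ∈ {b : Site θ.D × Fin θ.D | SideTouches (a.toZdIdx.Ω j) b.1 b.2},
        ‖la b.1‖ ≤ (8 * B₀' * (5 * (θ.D : ℝ) * θ.L * B₈) * (α₀ + α₁)) ∧ ((θ.L : ℝ) ^ j * a.toZdIdx.η) * ‖covDerivFwd a.toZdIdx.η U₀ b.2 la b.1‖ ≤ (8 * B₀' * (5 * (θ.D : ℝ) * θ.L * B₈) * (α₀ + α₁))) ∧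
        LanF146 θ.L a.toZdIdx.k a.toZdIdx.η (a.toZdIdx.Ω 0) a.toZdIdx.Λs U₀ φ (m + 1) (mgauge U₀ v⁻¹ U₁) ∧ Restr129 θ.L (m + 1) (a.toZdIdx.Λs (m + 1)) U₀ (u₁ * v) ∧ IsPeriodic P v))
    -- NODE N06's FIVE ANALYTIC BINDERS PER MEMBER AT EVERY TRUNCATION `m ≤ k`, at the genuine torus record with print's class (1.31) — HYPOTHESES ([4] Thm 3.11,
    -- (3.47)@−3, (3.45), (3.42)₃∕(3.43); dag-n06-b `B9SupplySockH59ZdSrcPer` §3's displayed inputs VERBATIM at `ι := toZdIdx`, `p := fun _ => P`; N06's object layer inhabits them)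
    (hinv : ∀ (a : IdxB8SubDPerκ θ P Mκ Rκ) (m : ℕ), m ≤ a.toZdIdx.k →
      InvAtHIPer P θ.L (opsAllZdPer τ θ.L P (fun k j => towerBondsP θ.L a.toZdIdx.Ω (a.toZdIdx.Λs k) j) ops₀) aI M a.toZdIdx m)
    (hglob : ∀ (a : IdxB8SubDPerκ θ P Mκ Rκ) (m : ℕ), m ≤ a.toZdIdx.k →
      GlobAtIPer P θ.L (opsAllZdPer τ θ.L P (fun k j => towerBondsP θ.L a.toZdIdx.Ω (a.toZdIdx.Λs k) j) ops₀) aT B₀N M a.toZdIdx m)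
    (hhol : ∀ (a : IdxB8SubDPerκ θ P Mκ Rκ) (m : ℕ), m ≤ a.toZdIdx.k →
      HolderAtIH2Per P θ.L (opsAllZdPer τ θ.L P (fun k j => towerBondsP θ.L a.toZdIdx.Ω (a.toZdIdx.Λs k) j) ops₀) aT Cβ β len M a.toZdIdx m)
    (hsrc : ∀ (a : IdxB8SubDPerκ θ P Mκ Rκ) (m : ℕ), m ≤ a.toZdIdx.k →
      SrcAtIPer P θ.L (opsAllZdPer τ θ.L P (fun k j => towerBondsP θ.L a.toZdIdx.Ω (a.toZdIdx.Λs k) j) ops₀) aS cS M a.toZdIdx m)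
    (hsrcH : ∀ (a : IdxB8SubDPerκ θ P Mκ Rκ) (m : ℕ), m ≤ a.toZdIdx.k →
      SrcHolderAtIH2Per P θ.L (opsAllZdPer τ θ.L P (fun k j => towerBondsP θ.L a.toZdIdx.Ω (a.toZdIdx.Λs k) j) ops₀) aS cSβ β len M a.toZdIdx m)
    -- [4]'s LETTERS FOR PROPOSITION 5 AT THE PERIODIC MEMBERS OF RECORD `a : IdxB8LanCκPer θ P Mκ Rκ`, RD currency (as in (13)′β: `B8Prop5ExistsZdLanPer`'s `SLet` and
    -- `B8Prop5UniqueZdLanPer`'s `SLetUBper` VERBATIM) — HYPOTHESES ([Balaban1985BackgroundPropagators] Thm 3.1 p. 397, Thms 3.2–3.3; NODE N06's periodic letters to serve)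
    (SLet : ∀ a : IdxB8LanCκPer θ P Mκ Rκ, ∀ α₀ : ℝ, 0 < α₀ → α₀ ≤ cL → InAk θ.L a.toZdLanIdx.k a.toZdLanIdx.η α₀ a.toZdLanIdx.Ω a.toZdLanIdx.U₀ →
      ∃ (g Δ : (Site θ.D → θ.𝔸) →ₗ[ℂ] (Site θ.D → θ.𝔸)) (q : (Site θ.D → θ.𝔸) →ₗ[ℂ] (ℕ → Site θ.D → θ.𝔸)) (qs : (ℕ → Site θ.D → θ.𝔸) →ₗ[ℂ] (Site θ.D → θ.𝔸))
        (Aw c : (ℕ → Site θ.D → θ.𝔸) →ₗ[ℂ] (ℕ → Site θ.D → θ.𝔸)) (H' : XSpace θ.D a.toZdLanIdx.k θ.𝔸 →ₗ[ℂ] (Site θ.D → θ.𝔸)),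
        (∀ x, (∀ (z : Site θ.D) (i : Fin θ.D), x (z + (P : ℤ) • e i) = x z) → ∀ y ∈ a.toZdLanIdx.Ω 0, (Δ (g x) + qs (Aw (q (g x)))) y = x y) ∧
        (∀ f, (∀ (z : Site θ.D) (i : Fin θ.D), f (z + (P : ℤ) • e i) = f z) → q (g (g (qs (c (q f))))) = q f) ∧
        (∀ (f : Site θ.D → θ.𝔸) (z : Site θ.D) (i : Fin θ.D), g f (z + (P : ℤ) • e i) = g f z) ∧
        (∀ f : Site θ.D → θ.𝔸, (∀ (z : Site θ.D) (i : Fin θ.D), f (z + (P : ℤ) • e i) = f z) →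
          ∀ (z : Site θ.D) (i : Fin θ.D), qs (c (q f)) (z + (P : ℤ) • e i) = qs (c (q f)) z) ∧
        (∀ (f : Site θ.D → θ.𝔸), ∀ x ∈ a.toZdLanIdx.Ω 0, Δ f x = covLap a.toZdLanIdx.η a.toZdLanIdx.U₀ ((a.toZdLanIdx.Ω 0).indicator f) x) ∧
        (∀ (μ : ℕ → Site θ.D → θ.𝔸), ∀ x ∈ a.toZdLanIdx.Ω 0, qs μ x = QT θ.L a.toZdLanIdx.k a.toZdLanIdx.Λ a.toZdLanIdx.U₀ μ x) ∧
        (∀ (f : Site θ.D → θ.𝔸) (j : ℕ), j ≤ a.toZdLanIdx.k → ∀ y ∈ a.toZdLanIdx.Λ j, q f j y = QprimeIter (zdBlocking θ.D θ.L) (bgT θ.L a.toZdLanIdx.U₀) j f y) ∧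
        (∀ (X : XSpace θ.D a.toZdLanIdx.k θ.𝔸) (x : Site θ.D), ‖H' X x‖ ≤ B₀'H * ‖X‖) ∧
        (∀ j, j ≤ a.toZdLanIdx.k → ∀ (X : XSpace θ.D a.toZdLanIdx.k θ.𝔸), ∀ p ∈ {b : Site θ.D × Fin θ.D | SideTouches (a.toZdLanIdx.Ω j) b.1 b.2},
          wt θ.L a.toZdLanIdx.η j * ‖covDerivFwd a.toZdLanIdx.η a.toZdLanIdx.U₀ p.2 (H' X) p.1‖ ≤ B₀'H * ‖X‖) ∧
        (∀ X : XSpace θ.D a.toZdLanIdx.k θ.𝔸, Bd2 θ.L a.toZdLanIdx.η a.toZdLanIdx.k a.toZdLanIdx.Ω (covLap a.toZdLanIdx.η a.toZdLanIdx.U₀ (H' X)) (B₂' * ‖X‖)) ∧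
        (∀ (X : XSpace θ.D a.toZdLanIdx.k θ.𝔸) (x : Site θ.D), x ∉ a.toZdLanIdx.Ω 0 → H' X x = 0) ∧
        (∀ X Y : XSpace θ.D a.toZdLanIdx.k θ.𝔸, (∀ p, Y p = -star (X p)) → ∀ x, H' Y x = -star (H' X x)) ∧
        (∀ X : XSpace θ.D a.toZdLanIdx.k θ.𝔸, (∀ (b : Fin (a.toZdLanIdx.k + 1) × Site θ.D) (i : Fin θ.D), X (b.1, b.2 + ((P : ℤ) / (θ.L : ℤ) ^ (b.1 : ℕ)) • e i) = X b) →
          ∀ (z : Site θ.D) (i : Fin θ.D), H' X (z + (P : ℤ) • e i) = H' X z) ∧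
        (∀ (Y : XSpace θ.D a.toZdLanIdx.k θ.𝔸), (∀ (b : Fin (a.toZdLanIdx.k + 1) × Site θ.D) (i : Fin θ.D), Y (b.1, b.2 + ((P : ℤ) / (θ.L : ℤ) ^ (b.1 : ℕ)) • e i) = Y b) →
          ∀ (j : ℕ) (hj : j ≤ a.toZdLanIdx.k) (y : Site θ.D), y ∈ a.toZdLanIdx.Λ j →
          QprimeIter (zdBlocking θ.D θ.L) (bgT θ.L a.toZdLanIdx.U₀) j (H' Y) y = Y (⟨j, Nat.lt_succ_of_le hj⟩, y)) ∧
        (∀ (f : Site θ.D → θ.𝔸) (r : ℝ), 0 ≤ r → Bd2 θ.L a.toZdLanIdx.η a.toZdLanIdx.k a.toZdLanIdx.Ω f r →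
          (∀ x, ‖g f x‖ ≤ BG * r) ∧ ∀ j, j ≤ a.toZdLanIdx.k → ∀ p ∈ {b : Site θ.D × Fin θ.D | SideTouches (a.toZdLanIdx.Ω j) b.1 b.2},
            wt θ.L a.toZdLanIdx.η j * ‖covDerivFwd a.toZdLanIdx.η a.toZdLanIdx.U₀ p.2 (g f) p.1‖ ≤ BG * r) ∧
        (∀ (f : Site θ.D → θ.𝔸) (x : Site θ.D), x ∉ a.toZdLanIdx.Ω 0 → g f x = 0) ∧
        (∀ f : Site θ.D → θ.𝔸, (∀ j, j ≤ a.toZdLanIdx.k → ∀ x ∈ a.toZdLanIdx.Ω j, IsSelfAdjoint (f x)) → ∀ x, IsSelfAdjoint (g f x)) ∧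
        (∀ (f : Site θ.D → θ.𝔸) (r : ℝ), 0 ≤ r → Bd2 θ.L a.toZdLanIdx.η a.toZdLanIdx.k a.toZdLanIdx.Ω f r →
          Bd2 θ.L a.toZdLanIdx.η a.toZdLanIdx.k a.toZdLanIdx.Ω (f - g (qs (c (q (g f))))) (BR * r)) ∧
        (∀ f : Site θ.D → θ.𝔸, (∀ j, j ≤ a.toZdLanIdx.k → ∀ x ∈ a.toZdLanIdx.Ω j, IsSelfAdjoint (f x)) →
          ∀ j, j ≤ a.toZdLanIdx.k → ∀ x ∈ a.toZdLanIdx.Ω j, IsSelfAdjoint ((f - g (qs (c (q (g f))))) x)))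
    (SLetUB : ∀ a : IdxB8LanCκPer θ P Mκ Rκ, ∀ α₀ : ℝ, 0 < α₀ → α₀ ≤ cL → InAk θ.L a.toZdLanIdx.k a.toZdLanIdx.η α₀ a.toZdLanIdx.Ω a.toZdLanIdx.U₀ →
      ∃ (g Δ : (Site θ.D → θ.𝔸) →ₗ[ℂ] (Site θ.D → θ.𝔸)) (q : (Site θ.D → θ.𝔸) →ₗ[ℂ] (ℕ → Site θ.D → θ.𝔸)) (qs : (ℕ → Site θ.D → θ.𝔸) →ₗ[ℂ] (Site θ.D → θ.𝔸))
        (Aw c : (ℕ → Site θ.D → θ.𝔸) →ₗ[ℂ] (ℕ → Site θ.D → θ.𝔸)) (H' : XSpace θ.D a.toZdLanIdx.k θ.𝔸 →ₗ[ℂ] (Site θ.D → θ.𝔸)),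
        (∀ x : Site θ.D → θ.𝔸, (∀ (z : Site θ.D) (i : Fin θ.D), x (z + (P : ℤ) • e i) = x z) → (∃ C : ℝ, ∀ y, ‖x y‖ ≤ C) →
          g (Δ x + qs (Aw (q x))) = x) ∧
        (∀ φ : ℕ → Site θ.D → θ.𝔸, (∀ n, n ≤ a.toZdLanIdx.k → ∀ (y : Site θ.D) (i : Fin θ.D), φ n (y + ((P : ℤ) / (θ.L : ℤ) ^ n) • e i) = φ n y) →
          qs (c (q (g (g (qs φ))))) = qs φ) ∧
        (∀ (f : Site θ.D → θ.𝔸), ∀ x ∈ a.toZdLanIdx.Ω 0, Δ f x = covLap a.toZdLanIdx.η a.toZdLanIdx.U₀ ((a.toZdLanIdx.Ω 0).indicator f) x) ∧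
        (∀ (μ : ℕ → Site θ.D → θ.𝔸), ∀ x ∈ a.toZdLanIdx.Ω 0, qs μ x = QT θ.L a.toZdLanIdx.k a.toZdLanIdx.Λ a.toZdLanIdx.U₀ μ x) ∧
        (∀ (f : Site θ.D → θ.𝔸) (n : ℕ), n ≤ a.toZdLanIdx.k → ∀ y ∈ a.toZdLanIdx.Λ n, q f n y = QprimeIter (zdBlocking θ.D θ.L) (bgT θ.L a.toZdLanIdx.U₀) n f y) ∧
        (∀ (f : Site θ.D → θ.𝔸) (n : ℕ) (y : Site θ.D), ¬ (n ≤ a.toZdLanIdx.k ∧ y ∈ a.toZdLanIdx.Λ n) → q f n y = 0) ∧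
        (∀ (f : Site θ.D → θ.𝔸) (z : Site θ.D) (i : Fin θ.D), g f (z + (P : ℤ) • e i) = g f z) ∧
        (∀ μ : ℕ → Site θ.D → θ.𝔸, ∀ n, n ≤ a.toZdLanIdx.k → ∀ (y : Site θ.D) (i : Fin θ.D), Aw μ n (y + ((P : ℤ) / (θ.L : ℤ) ^ n) • e i) = Aw μ n y) ∧
        (∀ (X : XSpace θ.D a.toZdLanIdx.k θ.𝔸) (x : Site θ.D), ‖H' X x‖ ≤ B₀'H * ‖X‖) ∧
        (∀ n, n ≤ a.toZdLanIdx.k → ∀ (X : XSpace θ.D a.toZdLanIdx.k θ.𝔸), ∀ b ∈ {b : Site θ.D × Fin θ.D | SideTouches (a.toZdLanIdx.Ω n) b.1 b.2},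
          wt θ.L a.toZdLanIdx.η n * ‖covDerivFwd a.toZdLanIdx.η a.toZdLanIdx.U₀ b.2 (H' X) b.1‖ ≤ B₀'H * ‖X‖) ∧
        (∀ X : XSpace θ.D a.toZdLanIdx.k θ.𝔸, Bd2 θ.L a.toZdLanIdx.η a.toZdLanIdx.k a.toZdLanIdx.Ω (covLap a.toZdLanIdx.η a.toZdLanIdx.U₀ (H' X)) (B₂' * ‖X‖)) ∧
        (∀ X : XSpace θ.D a.toZdLanIdx.k θ.𝔸, (∀ (q : Fin (a.toZdLanIdx.k + 1) × Site θ.D) (i : Fin θ.D), X (q.1, q.2 + ((P : ℤ) / (θ.L : ℤ) ^ (q.1 : ℕ)) • e i) = X q) →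
          ∀ (z : Site θ.D) (i : Fin θ.D), H' X (z + (P : ℤ) • e i) = H' X z) ∧
        (∀ (Y : XSpace θ.D a.toZdLanIdx.k θ.𝔸), (∀ (q : Fin (a.toZdLanIdx.k + 1) × Site θ.D) (i : Fin θ.D), Y (q.1, q.2 + ((P : ℤ) / (θ.L : ℤ) ^ (q.1 : ℕ)) • e i) = Y q) →
          ∀ (n : ℕ) (hn : n ≤ a.toZdLanIdx.k) (y : Site θ.D), y ∈ a.toZdLanIdx.Λ n →
          QprimeIter (zdBlocking θ.D θ.L) (bgT θ.L a.toZdLanIdx.U₀) n (H' Y) y = Y (⟨n, Nat.lt_succ_of_le hn⟩, y)) ∧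
        (∀ (f : Site θ.D → θ.𝔸) (r : ℝ), 0 ≤ r → Bd2 θ.L a.toZdLanIdx.η a.toZdLanIdx.k a.toZdLanIdx.Ω f r →
          (∀ x, ‖g f x‖ ≤ BG * r) ∧ ∀ n, n ≤ a.toZdLanIdx.k → ∀ b ∈ {b : Site θ.D × Fin θ.D | SideTouches (a.toZdLanIdx.Ω n) b.1 b.2},
            wt θ.L a.toZdLanIdx.η n * ‖covDerivFwd a.toZdLanIdx.η a.toZdLanIdx.U₀ b.2 (g f) b.1‖ ≤ BG * r) ∧
        (∀ (f : Site θ.D → θ.𝔸) (r : ℝ), 0 ≤ r → Bd2 θ.L a.toZdLanIdx.η a.toZdLanIdx.k a.toZdLanIdx.Ω f r →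
          Bd2 θ.L a.toZdLanIdx.η a.toZdLanIdx.k a.toZdLanIdx.Ω (f - g (qs (c (q (g f))))) (BR * r))) :
    ∃ (lam : ResidB8 θ) (c₁ : ℝ) (ρ₀' : ℕ)
      (ax : ∀ j : IdxB8SubDPer θ P, (famB8OfRecordPer θ (lam.cutSubBP₅κPer P Mκ Rκ c₁ ρ₀').β (lam.cutSubBP₅κPer P Mκ Rκ c₁ ρ₀').len P j).Cfg →
        (famB8OfRecordPer θ (lam.cutSubBP₅κPer P Mκ Rκ c₁ ρ₀').β (lam.cutSubBP₅κPer P Mκ Rκ c₁ ρ₀').len P j).Pert →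
        (famB8OfRecordPer θ (lam.cutSubBP₅κPer P Mκ Rκ c₁ ρ₀').β (lam.cutSubBP₅κPer P Mκ Rκ c₁ ρ₀').len P j).Pert),
      0 < c₁ ∧ 1 ≤ ρ₀' ∧ B8LeafOfRecordSubBP₂DPerκ θ P Mκ Rκ ⟨lam.cutSubBP₅κPer P Mκ Rκ c₁ ρ₀', ax⟩ := by
  -- THE N06 PIN of `B₀` and `γ′`
  subst hB₀eq hγ'eq
  have hγ₈pos : 0 < γ₈ := lt_of_lt_of_le one_pos hγ₈
  have hB₀ : 0 < max 1 (2 * B₀N * max 1 (qQ θ.D θ.L Cτ (betaTau τ) 1)) := lt_of_lt_of_le one_pos (le_max_left _ _)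
  have hγ' : 0 ≤ 2 * cS * γ₈ / max 1 (2 * B₀N * max 1 (qQ θ.D θ.L Cτ (betaTau τ) 1)) :=
    div_nonneg (mul_nonneg (mul_nonneg zero_le_two hcS) hγ₈pos.le) hB₀.le
  have h5 : 0 ≤ 5 * (θ.D : ℝ) * θ.L := by positivity
  have hB8 : 2 ≤ 5 * (θ.D : ℝ) * θ.L * B₈ := hB.trans (mul_le_mul_of_nonneg_left hB₀8 h5)
  have hB₈ : 0 < B₈ := lt_of_lt_of_le hB₀ hB₀8
  have hden : 0 < 2 * B₀N * (14 * ((θ.D - 1 : ℕ) : ℝ)) * M + 1 := by positivity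
  have hcP3 : 0 < min (1 / 16) (min aI (min aT (min aS (1 / (2 * B₀N * (14 * ((θ.D - 1 : ℕ) : ℝ)) * M + 1))))) :=
    lt_min (by norm_num) (lt_min haI (lt_min haT (lt_min haS (one_div_pos.2 hden))))
  have hK₀ : 0 < 2 * (θ.L * (5 * (θ.D : ℝ) * θ.L * B₈)) + 8 * (8 * B₀' * (5 * (θ.D : ℝ) * θ.L * B₈)) := by
    have h1 : 0 < 5 * (θ.D : ℝ) * θ.L * B₈ := lt_of_lt_of_le two_pos hB8
    positivity
  have hcP₇ : 0 < min (min (1 / 16) (min aI (min aT (min aS (1 / (2 * B₀N * (14 * ((θ.D - 1 : ℕ) : ℝ)) * M + 1))))))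
      ((min (1 / 16) (min aI (min aT (min aS (1 / (2 * B₀N * (14 * ((θ.D - 1 : ℕ) : ℝ)) * M + 1)))))) /
        (2 * (θ.L * (5 * (θ.D : ℝ) * θ.L * B₈)) + 8 * (8 * B₀' * (5 * (θ.D : ℝ) * θ.L * B₈)))) := lt_min hcP3 (div_pos hcP3 hK₀)
  -- THE GUARDED SOURCED b9 SOCKET OF THEOREM 4's FRAME `SH59src` FROM NODE N06's BINDERS AT EVERY TRUNCATION (dag-n06-b FILE 7 §3), member laws BY NAME from the index
  have SH59src := sockH59srcPer_opsAllZdPer_towerBondsP θ.L τ hD θ.two_le_L hτp hτt hτs hCτ ops₀ hM1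
    (fun a : IdxB8SubDPerκ θ P Mκ Rκ => a.toZdIdx) (fun _ => P) (fun a => ⟨(a.pos).ne'⟩) (fun a => a.Ω_zero) (s := 1) (fun a => a.dvd)
    (fun a m hm j hj κ => B8PeriodicMemberGeometry.IdxB8SubD.isPeriodic_towerBondsP_Λs a.1.1 (fun l _ => a.1.periodic l) hm hj (a.1.pow_mul_div (hj.trans hm)).symm κ)
    (fun a m hm => levelSepPP0_of_levelSepPP (IdxB8SubD.levelSepPP_towerBondsP a.1.1 m hm))
    (β := β) (len := len) hinv hglob hhol hsrc hsrcH hB₀N hcS hcSβ γ₈ (B₈ := B₈) (B₀'' := B₀') hB₈ hB₀'.le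
  -- THE GUARDED BOTH-POINTS SOCKET OF PROPOSITION 3's FRAME AT PRINT'S CLASS, per member at truncation `k`, FROM THE SAME THREE BINDERS (dag-n06-b FILE 8 §3)
  have hden' : 0 < 2 * B₀N * (14 * ((θ.D - 1 : ℕ) : ℝ)) * M + 1 := hden
  have hcP3' : 0 < min (1 / 16) (min aI (min aT (1 / (2 * B₀N * (14 * ((θ.D - 1 : ℕ) : ℝ)) * M + 1)))) :=
    lt_min (by norm_num) (lt_min haI (lt_min haT (one_div_pos.2 hden')))
  have SB9H2Per : ∀ a : IdxB8SubDPerκ θ P Mκ Rκ, SockB9P3H2Per (𝔸 := θ.𝔸) P θ.L (max 1 (2 * B₀N * max 1 (qQ θ.D θ.L Cτ (betaTau τ) 1)))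
      (2 * max 0 Cβ * max 1 (qQ θ.D θ.L Cτ (betaTau τ) 1)) (min (1 / 16) (min aI (min aT (1 / (2 * B₀N * (14 * ((θ.D - 1 : ℕ) : ℝ)) * M + 1))))) β len
      a.toZdIdx.η a.toZdIdx.k a.toZdIdx.Ω a.toZdIdx.Λs (fun m l => towerBondsP θ.L a.toZdIdx.Ω (a.toZdIdx.Λs m) l) := fun a => by
    haveI : NeZero P := ⟨(a.pos).ne'⟩
    exact sockB9P3H2Per_opsAllZdPer_towerBondsP θ.L τ P hD θ.two_le_L hτp hτt hτs hCτ ops₀ hM1 a.toZdIdx a.Ω_zero a.dvd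
      (fun j hj κ => B8PeriodicMemberGeometry.IdxB8SubD.isPeriodic_towerBondsP_Λs a.1.1 (fun l _ => a.1.periodic l) le_rfl hj (a.1.pow_mul_div hj).symm κ)
      (levelSepPP0_of_levelSepPP (IdxB8SubD.levelSepPP_towerBondsP a.1.1 _ le_rfl)) (hinv a _ le_rfl) (hglob a _ le_rfl) (hhol a _ le_rfl) hB₀N
  -- (13)′β at the common threshold (the socket texts are antitone in the threshold), the truncation-`k` binders, everything else through
  exact exists_residB8_slot8κ'_of_bindersPer_p5Letters_at θ hD Mκ Rκ P τ hτp hτt hτs hCτ ops₀ hM1 haI haT haS hB₀N hCβ hcS hcSβ hB₀' rfl hB₀βeq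
    hB₀'H hB₂' hBG hBR hcL hfree hρ₀ hc₁s hP6 (lt_min hcP hcP₇) hcP3' hγ₈ hγ' hγ''eq hγβeq hB hB₀8 hγB hγB'' hB8β hB₁big
    (fun a α₀ α₁ h₀ h₁ hs => SP5base a α₀ α₁ h₀ h₁ (hs.trans (min_le_left _ _)))
    (fun a α₀ α₁ h₀ h₁ hs => SP5 a α₀ α₁ h₀ h₁ (hs.trans (min_le_left _ _)))
    (fun a α₀ α₁ h₀ h₁ hs => SH59src a α₀ α₁ h₀ h₁ (hs.trans (min_le_right _ _)))
    (fun a => hinv a _ le_rfl) (fun a => hglob a _ le_rfl) (fun a => hhol a _ le_rfl) (fun a => hsrc a _ le_rfl) (fun a => hsrcH a _ le_rfl)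
    (hB₀βeq ▸ SB9H2Per) SLet SLetUB

end BindersPerAll

end Summit.QuantumFields.YangMills.BalabanUVNodes.N05SubBP2DK2PerKappaSlotExistsOfBindersPerAllP5Letters

end
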